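/-
Copyright (c) 2026 the pub-hodgecm-mathlib formalisation cell (harness21).  Prover seat hodgecm-mathlib-K2Liu-p14 (g4), Track B «K2-LIT»,
#184♮ = hLiu418 = `stmt-HodgeConjecture-24832`; socket #41, KIND 1 (K1-b♮ LINE TERM), organ (K1b-W) «KIND W AT `n := 1` FOR THE PULLED-BACK
FAMILY» — LEAD F0P6-plan (g14) BATCH #77 (1); this seat's LINE WORD #1 (2026-09-04T22:42:47Z) currency ruling (1).  File (KW1-a′): the INSTANCE of
★ (KW1-a) at the translated corner family of ★ (KW1-e).  THEOREMS ONLY (no `def`, no `instance`, no notation, no named-fact hypothesis, no `sorry`).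
-/
import Summits.HodgeConjecture.HodgeConjecture.Theorems.K2LiuKindOneLineWhittakerHolomorphy   -- ★ (KW1-a) p862650: `differentiableOn_whittakerDelta_of_envelope`, envelope algebra
import Summits.HodgeConjecture.HodgeConjecture.Theorems.K2LiuKindOneLineWhittakerTranslate    -- ★ (KW1-e) PART 1 (F0P2-p10 (g2)): `norm_cornerTranslate_eq`, section ∕ continuity letters
import HarnessLib

/-!
# Crux `HLiu418`, socket #41, KIND 1 ∕ organ (K1b-W), file (KW1-a′): THE `hEbd` LETTER OF THE TRANSLATED CORNER FAMILY —
# `s ↦ W⁽ᴮ⁾_μ(x ↦ f_s(p₀ · blkD(1,x) · g))(y)` IS HOLOMORPHIC ON `{(n₂ − n₁)∕2 < re s}` (line case `n₁ = n₂ = 1`: ALL of `{0 < re s}`)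

Cell `hodgecm-mathlib`, crux item hLiu418 = `stmt-HodgeConjecture-24832` (helper lane `--supports … --as helper`, count-neutral), route of record
`HCCMUnconditional`; squad K2 ∕ K2Liu, road `K2_Liu`, socket #41 `sig_K2LiuSiegelEisensteinContinuation`, KIND 1, organ (K1b-W) (line lead K2Liu-p14 (g4);
hands LH7-p08 (KW1-b), K2E3-p26 (KW1-c), LH4-p09 (KW1-d), F0P2-p10 (KW1-e), LH4-p18 (KW1-f); K1 desk F0P2-p11 (g2); assembly (K1b-♮) LH4-p14 (g7)).
THE FAMILY OF THE ORGAN (LINE WORD #1 (1)) is ★ (KW1-e)'s translated corner family `Φ^{(p₀,g)} s x := f s (p₀ · blkD(1,x) · g)` — `f` a STANDARD family of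
`I_Δ^{(V)}(s, χ)` on the big doubled group `H(V)(𝔸)` (`V = A ⊕ B`, see-saw chart ★ `blkD`), `p₀ ∈ P_Δ(V)(𝔸)`, `g ∈ H(V)(𝔸)` FIXED — a Siegel family of
`I_Δ^{(B)}(s + n₁∕2, χ)` on `H(B)(𝔸)` (★ p862495 ∕ ★ `isSiegelDeltaSection_family_cornerTranslate`), holomorphic and continuous (★ `differentiableOn_∕continuous_cornerTranslate`),
but NOT `K`-flat.  THIS FILE discharges the fourth letter of ★ (KW1-a) `differentiableOn_whittakerDelta_of_envelope` — the VERTICAL-STRIP ENVELOPE — for it, and reads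
off the holomorphy of its twisted big-cell integral:
* §1 **`envelope_cornerTranslate`** — for `σ₀ ≤ re s ≤ σ₁` and every `x ∈ H(B)(𝔸)`:
  `‖f s (p₀·blkD(1,x)·g)‖ ≤ (1 + ρ + ρ⁻¹) · (‖f σ₀ (p₀·blkD(1,x)·g)‖ + ‖f σ₁ (p₀·blkD(1,x)·g)‖)`, `ρ = ‖σ_{χ,σ₀}(p₀)‖ ∕ ‖σ_{χ,σ₁}(p₀)‖` — ★ (KW1-a) §2 (c)
  `envelope_of_norm_eq_mul` fed by ★ (KW1-e) `norm_cornerTranslate_eq` (the scalar `σ_{χ,s}(p₀)`), ★ (KW1-a) §2 (a) (the standard family `f` is enveloped with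
  constant `1` on the big group) and §2 (b) (`σ_{χ,s}(p₀)` two-endpoint bounded, non-zero).
* §2 **`differentiableOn_whittakerDelta_cornerTranslate`** — `s ↦ whittakerDelta⁽ᴮ⁾ ν μ (Φ^{(p₀,g)} s) y` is `DifferentiableOn ℂ {n₂∕2 − n₁∕2 < re s}` for EVERY
  index `μ ∈ M_{n₂}(L)` and EVERY `y ∈ H(B)(𝔸)` (unitary `χ`, `ν` Haar on `N_Δ(B)(𝔸)`, `dB, dW ≠ 0`); **`…_halfPlane`** — for `n₂ ≤ n₁` on `{0 < re s}`; and
  **`differentiableOn_whittakerDelta_cornerTranslate_line`** — the K1-b♮ case `n₁ = n₂`: holomorphic on the WHOLE window `{0 < re s}` = the TOP ED. 16 letter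
  `hEbd` for `Ebc S s h ∝ W⁽¹⁾_{μ_S}(Φ^{(p₀, Λĝ·h)}_s)(1)` up to the constants of record ((K1b-♮) assembly, LH4-p14 (g7)).  NO continuation anywhere.
[KudlaRallis1994, §1–§2] [MoeglinWaldspurger1995, II.1.6–II.1.7, IV.1.9] [Tan1999, §1, §3] [Kudla1994, §2] [Garrett2018, §3.10].
HONEST LABEL.  Count-neutral helper; closes no socket by itself; `HC_CM` is proved only modulo the 7 printed citations (2 remaining named inputs: hLiu418 =
`stmt-HodgeConjecture-24832`, h413 = `stmt-HodgeConjecture-24833`) until rung 0 closes.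

## References
* [KudlaRallis1994] S. Kudla, S. Rallis, Ann. of Math. 140 (1994): §1–§2 (standard sections; holomorphy of `W_β(g, s, Φ)` on the half-plane).
* [MoeglinWaldspurger1995] C. Mœglin, J.-L. Waldspurger, *Spectral decomposition and Eisenstein series* (1995): II.1.6–II.1.7, IV.1.9.
* [Tan1999] V. Tan, Canad. J. Math. 51 (1999): §1, §3.   * [Kudla1994] S. Kudla, Israel J. Math. 87 (1994): §2 (see-saw embedding, Siegel parabolic).
* [Garrett2018] P. Garrett, *Modern Analysis of Automorphic Forms by Example* (2018): §3.10 (vertical-strip domination by the endpoints).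
-/

set_option autoImplicit false
-- the mandated namespace repeats the single-problem summit's segment (`HodgeConjecture.HodgeConjecture`)
set_option linter.dupNamespace false

noncomputable section

open scoped Matrix
open NumberField IsDedekindDomain MeasureTheory Measure

namespace Summit.HodgeConjecture.HodgeConjecture.Cruxes.HLiu418.K2LiuKindOneLineWhittakerHolomorphyCorner

open Literature.NumberTheory.Automorphic Literature.NumberTheory.GaloisRepresentations
open Literature.NumberTheory.GelbartRogawski1991 Literature.NumberTheory.GelbartRogawski1991.GRConstruction
open Literature.NumberTheory.K2Lit.SiegelDoubled
open Summit.HodgeConjecture.HodgeConjecture.Cruxes.HLiu418.K2LiuSiegelUnipotentFourierDefs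
open Summit.HodgeConjecture.HodgeConjecture.Cruxes.HLiu418.K2LiuKindOneLineWhittakerHolomorphy
open Summit.HodgeConjecture.HodgeConjecture.Cruxes.HLiu418.K2LiuKindOneLineWhittakerTranslate

variable (L : Type) [Field L] [NumberField L] [IsCMField L]
variable {N₁ N₂ M n n₁ n₂ : ℕ} (eV : Fin (N₁ + N₂) × Fin M ≃ Fin n) (eA : Fin N₁ × Fin M ≃ Fin n₁) (eB : Fin N₂ × Fin M ≃ Fin n₂)
  (dA : Fin N₁ → L) (hdA : ∀ i, IsCMField.complexConj L (dA i) = dA i)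
  (dB : Fin N₂ → L) (hdB : ∀ i, IsCMField.complexConj L (dB i) = dB i)
  (dV : Fin (N₁ + N₂) → L) (hdV : ∀ i, IsCMField.complexConj L (dV i) = dV i)
  (hVA : ∀ i, dV (Fin.castAdd N₂ i) = dA i) (hVB : ∀ j, dV (Fin.natAdd N₁ j) = dB j)
  (dW : Fin M → L) (hdW : ∀ i, IsCMField.complexConj L (dW i) = dW i)

/-! ## §1 The vertical-strip envelope of the translated corner family -/

/-- **THE ENVELOPE OF THE TRANSLATED CORNER FAMILY.**  `f` a STANDARD family of `I_Δ^{(V)}(·, χ)` for the Iwasawa datum `𝒦` (★ `IsStandardSectionFamily`), `χ` unitary,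
`p₀ ∈ P_Δ(V)(𝔸)`, `g ∈ H(V)(𝔸)`.  For real `σ₀ ≤ σ₁`, every `s` with `σ₀ ≤ re s ≤ σ₁` and every `x ∈ H(B)(𝔸)`:
`‖f s (p₀·blkD(1,x)·g)‖ ≤ (1 + ρ + ρ⁻¹) · (‖f σ₀ (p₀·blkD(1,x)·g)‖ + ‖f σ₁ (p₀·blkD(1,x)·g)‖)`, `ρ = ‖σ_{χ,σ₀}(p₀)‖ ∕ ‖σ_{χ,σ₁}(p₀)‖`
(★ `envelope_of_norm_eq_mul` ← ★ `norm_cornerTranslate_eq`, ★ `norm_apply_le_add_of_re_mem_Icc`, ★ `norm_siegelDeltaCharacter_le_add` ∕ `_pos`).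
[cite: Tan1999, §1] [cite: Garrett2018, §3.10] -/
theorem envelope_cornerTranslate {𝒦 : IwasawaDatum L eV dV hdV dW hdW} {χ : HeckeCharacter L} (hχ : χ.IsUnitary)
    {f : ℂ → HA L eV dV hdV dW hdW → ℂ} (hf : IsStandardSectionFamily 𝒦 χ f)
    {p₀ : HA L eV dV hdV dW hdW} (hp₀ : IsSiegelDelta L eV dV hdV dW hdW p₀) (g : HA L eV dV hdV dW hdW) (σ₀ σ₁ : ℝ) :
    ∀ s : ℂ, σ₀ ≤ s.re → s.re ≤ σ₁ → ∀ x : HA L eB dB hdB dW hdW,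
      ‖f s (p₀ * blkD L eV eA eB dA hdA dB hdB dV hdV hVA hVB dW hdW (1, x) * g)‖ ≤
        1 * (1 + ‖siegelDeltaCharacter L eV dV hdV dW hdW χ (σ₀ : ℂ) p₀‖ / ‖siegelDeltaCharacter L eV dV hdV dW hdW χ (σ₁ : ℂ) p₀‖ +
              ‖siegelDeltaCharacter L eV dV hdV dW hdW χ (σ₁ : ℂ) p₀‖ / ‖siegelDeltaCharacter L eV dV hdV dW hdW χ (σ₀ : ℂ) p₀‖) *
          (‖f (σ₀ : ℂ) (p₀ * blkD L eV eA eB dA hdA dB hdB dV hdV hVA hVB dW hdW (1, x) * g)‖ +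
            ‖f (σ₁ : ℂ) (p₀ * blkD L eV eA eB dA hdA dB hdB dV hdV hVA hVB dW hdW (1, x) * g)‖) :=
  envelope_of_norm_eq_mul (fun x : HA L eB dB hdB dW hdW => blkD L eV eA eB dA hdA dB hdB dV hdV hVA hVB dW hdW (1, x) * g)
    (F := f) (Φ := fun s x => f s (p₀ * blkD L eV eA eB dA hdA dB hdB dV hdV hVA hVB dW hdW (1, x) * g))
    (c := fun s => siegelDeltaCharacter L eV dV hdV dW hdW χ s p₀) zero_le_one
    (fun s h₀ h₁ Y' => by
      rw [one_mul]
      exact norm_apply_le_add_of_re_mem_Icc hχ hf (by rwa [Complex.ofReal_re]) (by rwa [Complex.ofReal_re]) Y')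
    (fun s h₀ h₁ => norm_siegelDeltaCharacter_le_add hχ (by rwa [Complex.ofReal_re]) (by rwa [Complex.ofReal_re]) p₀)
    (norm_pos_iff.1 (norm_siegelDeltaCharacter_pos hχ _ p₀)) (norm_pos_iff.1 (norm_siegelDeltaCharacter_pos hχ _ p₀))
    (fun s x => norm_cornerTranslate_eq L eV eA eB dA hdA dB hdB dV hdV hVA hVB dW hdW (hf.1.1 s) hp₀ g x)

/-- the envelope letter in the ∃-shape ★ (KW1-a) `differentiableOn_whittakerDelta_of_envelope` consumes (`∃ C, …` on every strip). [cite: Garrett2018, §3.10] -/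
theorem exists_envelope_cornerTranslate {𝒦 : IwasawaDatum L eV dV hdV dW hdW} {χ : HeckeCharacter L} (hχ : χ.IsUnitary)
    {f : ℂ → HA L eV dV hdV dW hdW → ℂ} (hf : IsStandardSectionFamily 𝒦 χ f)
    {p₀ : HA L eV dV hdV dW hdW} (hp₀ : IsSiegelDelta L eV dV hdV dW hdW p₀) (g : HA L eV dV hdV dW hdW) (σ₀ σ₁ : ℝ) :
    ∃ C : ℝ, ∀ s : ℂ, σ₀ ≤ s.re → s.re ≤ σ₁ → ∀ x : HA L eB dB hdB dW hdW,
      ‖f s (p₀ * blkD L eV eA eB dA hdA dB hdB dV hdV hVA hVB dW hdW (1, x) * g)‖ ≤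
        C * (‖f (σ₀ : ℂ) (p₀ * blkD L eV eA eB dA hdA dB hdB dV hdV hVA hVB dW hdW (1, x) * g)‖ +
              ‖f (σ₁ : ℂ) (p₀ * blkD L eV eA eB dA hdA dB hdB dV hdV hVA hVB dW hdW (1, x) * g)‖) :=
  ⟨_, envelope_cornerTranslate L eV eA eB dA hdA dB hdB dV hdV hVA hVB dW hdW hχ hf hp₀ g σ₀ σ₁⟩

/-! ## §2 Holomorphy of the twisted big-cell integral of the translated corner family -/

section Holomorphy

variable [MeasurableSpace (unipDelta L eB dB hdB dW hdW)] [BorelSpace (unipDelta L eB dB hdB dW hdW)]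

/-- **`s ↦ W⁽ᴮ⁾_μ(Φ^{(p₀,g)}_s)(y)` IS HOLOMORPHIC ON `{n₂∕2 − n₁∕2 < re s}`** — every index `μ ∈ M_{n₂}(L)`, every `y ∈ H(B)(𝔸)`; `f` standard on `H(V)(𝔸)`, `χ` unitary,
`p₀ ∈ P_Δ(V)(𝔸)`, `g ∈ H(V)(𝔸)`, `ν` a Haar measure on `N_Δ(B)(𝔸)`, `dB, dW ≠ 0`.  PROOF: ★ (KW1-a) `differentiableOn_whittakerDelta_of_envelope` on the `B`-datum at shift
`c = n₁∕2` with the four letters ★ (KW1-e) `isSiegelDeltaSection_family_cornerTranslate`, `differentiableOn_cornerTranslate`, `continuous_cornerTranslate` and §1.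
[cite: KudlaRallis1994, §1–§2] [cite: MoeglinWaldspurger1995, II.1.6–II.1.7, IV.1.9] [cite: Kudla1994, §2] -/
theorem differentiableOn_whittakerDelta_cornerTranslate (hdB0 : ∀ i, dB i ≠ 0) (hdW0 : ∀ i, dW i ≠ 0)
    {𝒦 : IwasawaDatum L eV dV hdV dW hdW} {χ : HeckeCharacter L} (hχ : χ.IsUnitary)
    {f : ℂ → HA L eV dV hdV dW hdW → ℂ} (hf : IsStandardSectionFamily 𝒦 χ f) (hfc : ∀ s, Continuous (f s))
    {p₀ : HA L eV dV hdV dW hdW} (hp₀ : IsSiegelDelta L eV dV hdV dW hdW p₀) (g : HA L eV dV hdV dW hdW)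
    (ν : Measure (unipDelta L eB dB hdB dW hdW)) [ν.IsHaarMeasure] (μ : Matrix (Fin n₂) (Fin n₂) L) (y : HA L eB dB hdB dW hdW) :
    DifferentiableOn ℂ (fun s => whittakerDelta L eB dB hdB dW hdW ν μ
      (fun x => f s (p₀ * blkD L eV eA eB dA hdA dB hdB dV hdV hVA hVB dW hdW (1, x) * g)) y) {s : ℂ | (n₂ : ℝ) / 2 - (n₁ : ℝ) / 2 < s.re} := by
  have hc : (((n₁ : ℂ) / 2).re) = (n₁ : ℝ) / 2 := by simp
  have h := differentiableOn_whittakerDelta_of_envelope L eB dB hdB dW hdW hdB0 hdW0 hχ ((n₁ : ℂ) / 2)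
    (Φ := fun s x => f s (p₀ * blkD L eV eA eB dA hdA dB hdB dV hdV hVA hVB dW hdW (1, x) * g))
    (isSiegelDeltaSection_family_cornerTranslate L eV eA eB dA hdA dB hdB dV hdV hVA hVB dW hdW hf.1.1 hp₀ g)
    (fun x => differentiableOn_cornerTranslate L eV eA eB dA hdA dB hdB dV hdV hVA hVB dW hdW (fun y' => (hf.1.2 y').differentiableOn) p₀ g x)
    (fun s => continuous_cornerTranslate L eV eA eB dA hdA dB hdB dV hdV hVA hVB dW hdW (hfc s) p₀ g)
    (fun σ₀ σ₁ _ _ => exists_envelope_cornerTranslate L eV eA eB dA hdA dB hdB dV hdV hVA hVB dW hdW hχ hf hp₀ g σ₀ σ₁) ν μ y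
  rwa [hc] at h

/-- the same on `{0 < re s}` whenever `n₂ ≤ n₁` (the window contains the right half-plane). [cite: KudlaRallis1994, §1–§2] [cite: MoeglinWaldspurger1995, IV.1.9] -/
theorem differentiableOn_whittakerDelta_cornerTranslate_halfPlane (hdB0 : ∀ i, dB i ≠ 0) (hdW0 : ∀ i, dW i ≠ 0) (hle : n₂ ≤ n₁)
    {𝒦 : IwasawaDatum L eV dV hdV dW hdW} {χ : HeckeCharacter L} (hχ : χ.IsUnitary)
    {f : ℂ → HA L eV dV hdV dW hdW → ℂ} (hf : IsStandardSectionFamily 𝒦 χ f) (hfc : ∀ s, Continuous (f s))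
    {p₀ : HA L eV dV hdV dW hdW} (hp₀ : IsSiegelDelta L eV dV hdV dW hdW p₀) (g : HA L eV dV hdV dW hdW)
    (ν : Measure (unipDelta L eB dB hdB dW hdW)) [ν.IsHaarMeasure] (μ : Matrix (Fin n₂) (Fin n₂) L) (y : HA L eB dB hdB dW hdW) :
    DifferentiableOn ℂ (fun s => whittakerDelta L eB dB hdB dW hdW ν μ
      (fun x => f s (p₀ * blkD L eV eA eB dA hdA dB hdB dV hdV hVA hVB dW hdW (1, x) * g)) y) {s : ℂ | 0 < s.re} :=
  (differentiableOn_whittakerDelta_cornerTranslate L eV eA eB dA hdA dB hdB dV hdV hVA hVB dW hdW hdB0 hdW0 hχ hf hfc hp₀ g ν μ y).mono fun s hs => by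
    have hs' : 0 < s.re := hs
    have hle' : (n₂ : ℝ) ≤ (n₁ : ℝ) := by exact_mod_cast hle
    show (n₂ : ℝ) / 2 - (n₁ : ℝ) / 2 < s.re
    linarith

/-- **THE K1-b♮ LETTER `hEbd` (LINE CASE `n₁ = n₂`, e.g. `N₁ = N₂ = M = 1`): `s ↦ W⁽ᴮ⁾_μ(x ↦ f_s(p₀·blkD(1,x)·g))(y)` IS HOLOMORPHIC ON THE WHOLE WINDOW `{0 < re s}`**,
for every standard family `f` on `H(V)(𝔸)`, unitary `χ`, `p₀ ∈ P_Δ(V)(𝔸)`, `g ∈ H(V)(𝔸)`, Haar `ν`, index `μ`, point `y` — the continued normalised line term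
`Ebc S s h ∝ W⁽¹⁾_{μ_S}(Φ^{(p₀, Λĝ·h)}_s)(1)` of TOP ED. 16 is holomorphic in `s` with NO continuation (Godement's half-plane of the line at inner parameter `s + ½` is the window).
[cite: KudlaRallis1994, §1–§2] [cite: Tan1999, §3 (`n = 1`)] [cite: MoeglinWaldspurger1995, IV.1.9] -/
theorem differentiableOn_whittakerDelta_cornerTranslate_line (hdB0 : ∀ i, dB i ≠ 0) (hdW0 : ∀ i, dW i ≠ 0) (hn : n₁ = n₂)
    {𝒦 : IwasawaDatum L eV dV hdV dW hdW} {χ : HeckeCharacter L} (hχ : χ.IsUnitary)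
    {f : ℂ → HA L eV dV hdV dW hdW → ℂ} (hf : IsStandardSectionFamily 𝒦 χ f) (hfc : ∀ s, Continuous (f s))
    {p₀ : HA L eV dV hdV dW hdW} (hp₀ : IsSiegelDelta L eV dV hdV dW hdW p₀) (g : HA L eV dV hdV dW hdW)
    (ν : Measure (unipDelta L eB dB hdB dW hdW)) [ν.IsHaarMeasure] (μ : Matrix (Fin n₂) (Fin n₂) L) (y : HA L eB dB hdB dW hdW) :
    DifferentiableOn ℂ (fun s => whittakerDelta L eB dB hdB dW hdW ν μ
      (fun x => f s (p₀ * blkD L eV eA eB dA hdA dB hdB dV hdV hVA hVB dW hdW (1, x) * g)) y) {s : ℂ | 0 < s.re} :=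
  differentiableOn_whittakerDelta_cornerTranslate_halfPlane L eV eA eB dA hdA dB hdB dV hdV hVA hVB dW hdW hdB0 hdW0 hn.symm.le hχ hf hfc hp₀ g ν μ y

end Holomorphy

end Summit.HodgeConjecture.HodgeConjecture.Cruxes.HLiu418.K2LiuKindOneLineWhittakerHolomorphyCorner

end
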